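import Summits.AtomisticToContinuum.Crystallization.Theorems.ChartedZeroExcessLayeredLatticeLiouvilleVF

/-!
# Zero-excess layered lattice Liouville — part VG (lens-2 g57, node «ModalLipschitz»): (LD) REDUCED to a `t`-FREE POINTWISE statement.

`ModalLipschitzAt C ϱ n₁ a b w` — POINTWISE MODAL `C¹`-EXCESS: every field `φ` truncated-harmonic on `idxBall x₀ n` (`n ≥ n₁`) admits a truncated mode `M`
with `n² · #B_n · ‖(φ − M) Y − (φ − M) X‖² ≤ C · (dist X x₀ + 1)² · idxEnergy φ B_n` for every unit bond `(X, Y)` of the half ball — the discrete form of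
`|∇(u − M)(x)| ≲ (|x − x₀|/n) · (energy density)^{1/2}`, the output of the laminate regularity argument (tangential ladder VC + mixed embedding VD/VE +
flux identity VF + cross-layer inversion + mode extraction).  Proved here:
* ★★ `modalDecayAt_of_modalLipschitzAt` — `ModalLipschitzAt C ϱ n₁ ⇒ ModalDecayAt (108 C) ϱ t (max n₁ (1/t))` for every `t ∈ (0, 1/2]`: the Campanato
  rate `t²` of (LD) is EXACTLY the pointwise `C¹`-excess summed over the `≤ 27 · #B_{tn}` unit bonds of the small ball, once `t n ≥ 1`;
* ★★ `linearExcessDecayZ_of_modalLipschitzZ` — with the uniform wrapper `ModalLipschitzZ` (same certificate skeleton as (LD), NO `t`):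
  `ModalLipschitzZ → LinearExcessDecayZ`.  So the (LD) leaf may be attacked through the `t`-free pointwise statement; (LD)'s quantifier order
  (`n₁` after `t`) is precisely what the choice `n₁(t) = max n₁ (1/t)` uses.
Bricks / reduction of (LD) `LinearExcessDecayZ`; nothing of the column is re-typed, nothing here is an item.
-/

noncomputable section

open scoped BigOperators InnerProductSpace RealInnerProductSpace
open MeasureTheory Set Metric Filter Topology
open Summit.AtomisticToContinuum.Crystallization.Theorems.ChartedPlanarOrderRigidityDoor (E3 IsNash atomsIn)
open Summit.AtomisticToContinuum.Crystallization.Theorems.ChartedPlanarOrderDensityDichotomy (μS IsSep nK nK_nonneg)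
open Summit.AtomisticToContinuum.Crystallization.Theorems.ChartedPlanarOrderDoorLayered (Layered layeredHom_eq_layered)

namespace Summit.AtomisticToContinuum.Crystallization.Theorems.ChartedZeroExcessLayeredLatticeLiouville

section ModalLipschitz

variable {c : ℝ} {a b : E3} {w : ℤ → E3}

/-! ### VG.1  The pointwise modal excess and its uniform wrapper -/

/-- **POINTWISE MODAL `C¹`-EXCESS** `ModalLipschitzAt C ϱ n₁ a b w`: for every `φ` truncated-harmonic on `idxBall x₀ n`, `n ≥ n₁`, there is a truncated mode
`M` such that every unit bond `(X, Y)` of `idxBall x₀ (n/2)` satisfies `n² · #idxBall x₀ n · ‖(φ − M) Y − (φ − M) X‖² ≤ C · (dist X x₀ + 1)² · idxEnergy φ (idxBall x₀ n)`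
(scale-invariant: `|∇(φ − M)(X)|² ≲ ((|X − x₀| + 1)/n)² × energy density).  The `+1` is the lattice floor (one bond).
REGISTRATION: the package of the open leaf (LD′) `ModalLipschitzZ` of stmt-AtomisticToContinuum-26636, registered critic row 915; (LD′) reduces to (LD)
by `linearExcessDecayZ_of_modalLipschitzZ`. [this file, g57] -/
def ModalLipschitzAt (C ϱ n₁ : ℝ) (a b : E3) (w : ℤ → E3) : Prop :=
  ∀ (φ : Cell 2 → ℤ → E3) (x₀ : Cell 2 × ℤ) (n : ℝ), n₁ ≤ n →
    IsTruncHarmonicZ ϱ a b w φ (idxBall x₀ n) →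
      ∃ M : Cell 2 → ℤ → E3, IsTruncMode ϱ a b w M ∧
        ∀ X Y : Cell 2 × ℤ, X ∈ idxBall x₀ (n / 2) → Y ∈ idxBall x₀ (n / 2) → dist X Y ≤ 1 →
          n ^ 2 * ((idxBall x₀ n).ncard : ℝ) * ‖(φ - M) Y.1 Y.2 - (φ - M) X.1 X.2‖ ^ 2 ≤
            C * (dist X x₀ + 1) ^ 2 * idxEnergy φ (idxBall x₀ n)

/-- **`ModalLipschitzZ`** — the `t`-FREE form of (LD): same certificate skeleton (`TailDominationCert`, `(κ₀, c₀, C₁)`, `C ≥ 1`, `ϱ ≥ ϱ₁ ≥ 1`, ONE scale `n₁ > 0`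
per `ϱ`), conclusion `ModalLipschitzAt C ϱ n₁ ∧ ModeRigidAt C ϱ n₁` for every certified laminate.
REGISTRATION: «open leaf (LD′) of stmt-AtomisticToContinuum-26636, registered critic row 915; reduces to (LD) by `linearExcessDecayZ_of_modalLipschitzZ`»
— (LD) `LinearExcessDecayZ` ⟸ (LD′) `ModalLipschitzZ` [UNDECIDED · ATTACKABLE · laminate-structured: TRUE-type exactly when the truncated-mode family carries the
free layer profile (conormal inversion; Chipot–Kinderlehrer–Vergara-Caffarelli 1986, Li–Vogelius 2000, Li–Nirenberg 2003) — it does: `isTruncMode_of_profile`, part VH]. [this file, g57] -/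
def ModalLipschitzZ : Prop :=
  TailDominationCert → ∀ κ₀ : ℝ, 0 < κ₀ → ∀ c₀ : ℝ, 0 < c₀ → ∀ C₁ : ℝ, 0 < C₁ →
    ∃ C : ℝ, 1 ≤ C ∧ ∃ ϱ₁ : ℝ, 1 ≤ ϱ₁ ∧ ∀ ϱ : ℝ, ϱ₁ ≤ ϱ → ∃ n₁ : ℝ, 0 < n₁ ∧
      ∀ (a b : E3) (w : ℤ → E3), IsLayeredCrystal c₀ a b w → IsTameIndexing C₁ a b w → CoerciveZ (layeredKernel a b w) κ₀ →
        ModalLipschitzAt C ϱ n₁ a b w ∧ ModeRigidAt C ϱ n₁ a b w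

/-! ### VG.2  Counting unit bonds -/

/-- a unit index ball has exactly `27` sites. [formal bookkeeping] -/
theorem card_idxBallF_one (X : Cell 2 × ℤ) : (idxBallF X 1).card = 27 := by
  rw [card_idxBallF_eq X zero_le_one, Nat.floor_one]
  norm_num

/-- the number of ordered unit bonds of a finite site set is at most `27 · #Q`. [this file, g57] -/
theorem card_unitPairs_le (Q : Finset (Cell 2 × ℤ)) : ((Q ×ˢ Q).filter (fun x => dist x.1 x.2 ≤ 1)).card ≤ 27 * Q.card := by
  have hsub : (Q ×ˢ Q).filter (fun x => dist x.1 x.2 ≤ 1) ⊆ Q.biUnion (fun X => (idxBallF X 1).image (fun Y => (X, Y))) := by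
    intro x hx
    rw [Finset.mem_filter, Finset.mem_product] at hx
    refine Finset.mem_biUnion.mpr ⟨x.1, hx.1.1, Finset.mem_image.mpr ⟨x.2, ?_, rfl⟩⟩
    rw [mem_idxBallF, dist_comm]
    exact hx.2
  calc ((Q ×ˢ Q).filter (fun x => dist x.1 x.2 ≤ 1)).card
      ≤ (Q.biUnion (fun X => (idxBallF X 1).image (fun Y => (X, Y)))).card := Finset.card_le_card hsub
    _ ≤ ∑ X ∈ Q, ((idxBallF X 1).image (fun Y => (X, Y))).card := Finset.card_biUnion_le
    _ ≤ ∑ X ∈ Q, 27 := Finset.sum_le_sum fun X _ => Finset.card_image_le.trans (card_idxBallF_one X).le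
    _ = 27 * Q.card := by rw [Finset.sum_const, smul_eq_mul, mul_comm]

/-! ### VG.3  ★★ Pointwise excess ⇒ Campanato decay -/

/-- `ModeRigidAt` is monotone in the constant and the scale. [formal bookkeeping] -/
theorem modeRigidAt_mono {C C' ϱ n₁ n₁' : ℝ} (hC : C ≤ C') (hn : n₁ ≤ n₁') (h : ModeRigidAt C ϱ n₁ a b w) : ModeRigidAt C' ϱ n₁' a b w := by
  intro M hM x₀ n hn' X Y
  refine (h M hM x₀ n (hn.trans hn') X Y).trans ?_
  have hE : 0 ≤ dist X Y ^ 2 * idxEnergy M (idxBall x₀ n) := mul_nonneg (sq_nonneg _) (idxEnergy_nonneg M _)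
  nlinarith

/-- ★★ **POINTWISE MODAL EXCESS ⇒ CAMPANATO DECAY**: `ModalLipschitzAt C ϱ n₁ ⇒ ModalDecayAt (108 C) ϱ t (max n₁ (1/t))` for `t ∈ (0, 1/2]` — sum the pointwise
bound over the `≤ 27 · #B_{tn}` ordered unit bonds of `idxBall x₀ (t n) ⊆ idxBall x₀ (n/2)`, using `dist X x₀ + 1 ≤ 2 t n` once `t n ≥ 1`. [this file, g57] -/
theorem modalDecayAt_of_modalLipschitzAt {C ϱ n₁ t : ℝ} (hC : 0 ≤ C) (ht : 0 < t) (ht2 : t ≤ 1 / 2) (h : ModalLipschitzAt C ϱ n₁ a b w) :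
    ModalDecayAt (108 * C) ϱ t (max n₁ (1 / t)) a b w := by
  intro φ x₀ n hn hφ
  have hn₁ : n₁ ≤ n := (le_max_left _ _).trans hn
  have hnt : 1 / t ≤ n := (le_max_right _ _).trans hn
  have htn1 : 1 ≤ t * n := by
    rw [div_le_iff₀ ht] at hnt
    linarith
  have hn0 : 0 < n := by
    have : 0 < 1 / t := by positivity
    linarith
  obtain ⟨M, hM, hb⟩ := h φ x₀ n hn₁ hφ
  refine ⟨M, hM, ?_⟩
  -- the small ball as a finset and its unit bonds
  have hcoe : idxBall x₀ (t * n) = ↑(idxBallF x₀ (t * n)) := (coe_idxBallF x₀ (t * n)).symm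
  rw [hcoe, idxEnergy_coe_finset, Set.ncard_coe_finset, Finset.sum_mul]
  have hsub : ∀ X : Cell 2 × ℤ, X ∈ idxBallF x₀ (t * n) → X ∈ idxBall x₀ (n / 2) := fun X hX => by
    have hX' := mem_idxBallF.mp hX
    show dist X x₀ ≤ n / 2
    nlinarith
  -- per bond
  have hbond : ∀ x ∈ (idxBallF x₀ (t * n) ×ˢ idxBallF x₀ (t * n)).filter (fun x => dist x.1 x.2 ≤ 1),
      ‖(φ - M) x.2.1 x.2.2 - (φ - M) x.1.1 x.1.2‖ ^ 2 * ((idxBall x₀ n).ncard : ℝ) ≤ 4 * C * t ^ 2 * idxEnergy φ (idxBall x₀ n) := by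
    intro x hx
    rw [Finset.mem_filter, Finset.mem_product] at hx
    have hX := hb x.1 x.2 (hsub x.1 hx.1.1) (hsub x.2 hx.1.2) hx.2
    have hd : dist x.1 x₀ + 1 ≤ 2 * (t * n) := by
      have := mem_idxBallF.mp hx.1.1
      linarith
    have hd0 : 0 ≤ dist x.1 x₀ + 1 := by positivity
    have hE := idxEnergy_nonneg φ (idxBall x₀ n)
    have h2 : C * (dist x.1 x₀ + 1) ^ 2 * idxEnergy φ (idxBall x₀ n) ≤ C * (2 * (t * n)) ^ 2 * idxEnergy φ (idxBall x₀ n) := by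
      have := pow_le_pow_left₀ hd0 hd 2
      gcongr
    have h3 : n ^ 2 * (‖(φ - M) x.2.1 x.2.2 - (φ - M) x.1.1 x.1.2‖ ^ 2 * ((idxBall x₀ n).ncard : ℝ)) ≤
        n ^ 2 * (4 * C * t ^ 2 * idxEnergy φ (idxBall x₀ n)) := by
      have := hX.trans h2
      nlinarith
    exact le_of_mul_le_mul_left h3 (by positivity)
  refine (Finset.sum_le_sum hbond).trans ?_
  rw [Finset.sum_const, nsmul_eq_mul]
  have hcard := card_unitPairs_le (idxBallF x₀ (t * n))
  have hcardR : (((idxBallF x₀ (t * n) ×ˢ idxBallF x₀ (t * n)).filter (fun x => dist x.1 x.2 ≤ 1)).card : ℝ) ≤ 27 * (idxBallF x₀ (t * n)).card := by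
    exact_mod_cast hcard
  have hE : 0 ≤ 4 * C * t ^ 2 * idxEnergy φ (idxBall x₀ n) := by
    have := idxEnergy_nonneg φ (idxBall x₀ n)
    positivity
  calc ((((idxBallF x₀ (t * n) ×ˢ idxBallF x₀ (t * n)).filter (fun x => dist x.1 x.2 ≤ 1)).card : ℝ)) * (4 * C * t ^ 2 * idxEnergy φ (idxBall x₀ n))
      ≤ (27 * (idxBallF x₀ (t * n)).card) * (4 * C * t ^ 2 * idxEnergy φ (idxBall x₀ n)) := mul_le_mul_of_nonneg_right hcardR hE
    _ = 108 * C * t ^ 2 * idxEnergy φ (idxBall x₀ n) * ((idxBallF x₀ (t * n)).card : ℝ) := by ring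

/-- ★★ **THE REDUCTION OF (LD)**: `ModalLipschitzZ → LinearExcessDecayZ` (constants `C ↦ 108 C`, `n₁(ϱ, t) = max (n₁ ϱ) (1/t)`). [this file, g57] -/
theorem linearExcessDecayZ_of_modalLipschitzZ (h : ModalLipschitzZ) : LinearExcessDecayZ := by
  intro hT κ₀ hκ₀ c₀ hc₀ C₁ hC₁
  obtain ⟨C, hC, ϱ₁, hϱ₁, hϱ⟩ := h hT κ₀ hκ₀ c₀ hc₀ C₁ hC₁
  refine ⟨108 * C, by linarith, ϱ₁, hϱ₁, fun ϱ hle t ht ht2 => ?_⟩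
  obtain ⟨n₁, hn₁, hlam⟩ := hϱ ϱ hle
  refine ⟨max n₁ (1 / t), lt_max_iff.mpr (Or.inl hn₁), fun a b w hL hI hK => ?_⟩
  obtain ⟨hML, hMR⟩ := hlam a b w hL hI hK
  exact ⟨modalDecayAt_of_modalLipschitzAt (by linarith) ht ht2 hML, modeRigidAt_mono (by linarith) (le_max_left _ _) hMR⟩

end ModalLipschitz

end Summit.AtomisticToContinuum.Crystallization.Theorems.ChartedZeroExcessLayeredLatticeLiouville
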